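import Summits.QuantumAdvantage.AdviceFreeQNC0.StructuredBound
import HarnessLib

/-!
# Cell qa-qnc0 (rung F-Q2-odd, `p = 3`): THEOREM A′ `PredHardDWB3` and R3 `OneBellDWB3` — PROVED

Planner qa-qnc0-p1 g16, `ROUND-15.md` §2–§3 (formalisation map L7, the accounting), THEOREM A′:
for every cut `k`, no `𝔽₃`-polynomial of degree `≤ (log₂ N)^C` predicts the stake `D_k` of the ring game on more than
`(1/3 + ε)·2^{N-1}` odd-class patterns.  Assembly of the line:

* `card_predict_le` — for a window `[a, a+(m+1)L)` with constant weight, `L, Lf ≥ 3`, `(m+1)L = K(6ℓ+1) + Lf`: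
  `3·#{x odd : g(x) = D_k(x)} ≤ 2^n·(1 + 4/2^L)^{m+1}·(1 + 2/2^K + 18·2^K·ΔL/√ℓ)`
  (`GaugeCount.sum_odd_le` × `StructuredBound.sum_Vsum_affP_le` × `card_Yset`);
* `predHardDWB3 : PredHardDWB3` — parameters `L = log₂ N`, `2^K ≥ 8/ε`, `ℓ = (A·Δ·L)²` with `A > 72·2^K/ε`,
  `m + 1 = ⌊K(6ℓ+1)/L⌋ + 4`, window placed on the side of `k` where the weight is constant (`2W ≤ n`); everything
  is `polylog(N) ≤ N` (`TubePlanProof.logPow_le_natSqrt`) plus `(1+x)^M ≤ 1 + 2Mx` for `Mx ≤ 1/2`;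
* **`oneBellDWB3 : OneBellDWB3`** (Sketch18 §6 R3, domain-wall blindness) := `oneBellOfPred predHardDWB3`.

WHAT THIS IS NOT: not `BShotDWB3` (the B-shot law needs the window-removal step on top of this file), not the dense regime,
not `RingHardOdd 3`; separation NOT moved.
-/

noncomputable section

namespace Summit.QuantumAdvantage.AdviceFreeQNC0

namespace DWalk

open Finset Equiv
open Literature.Computability.MetaComplexity Literature.Computability.MetaComplexity.Smolensky

/-! ### The count for fixed parameters -/

/-- **Main count**: `3·#{x odd : g(x) = D_k(x)} ≤ 2^n·(1 + 4/2^L)^{m+1}·(1 + 2/2^K + 18·2^K·ΔL/√ℓ)`. -/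
theorem card_predict_le {n a L m K ℓ Lf k : ℕ} {κ₀ : ZMod 3} (hκ : κ₀ ≠ 0) (hκ0 : KappaConst a L m κ₀ k)
    (haW : a + (m + 1) * L ≤ n) (hk : k ≤ n) (hL : 3 ≤ L) (hℓ : 1 ≤ ℓ) (hLf : 3 ≤ Lf)
    (hW : (m + 1) * L = K * (6 * ℓ + 1) + Lf) {Δ : ℕ} {g : CubeFn (ZMod 3) (n + 1)}
    (hg : g ∈ lowDeg (ZMod 3) (n + 1) Δ) :
    3 * ((univ.filter fun x : Fin (n + 1) → Bool =>
        (univ.filter fun j : Fin (n + 1) => x j = false).card % 2 = 1 ∧ g x = Dk3 x k).card : ℝ) ≤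
      (2 : ℝ) ^ n * (1 + 4 / (2 : ℝ) ^ L) ^ (m + 1) *
        (1 + 2 / (2 : ℝ) ^ K + 18 * (2 : ℝ) ^ K * ((Δ * L : ℕ) : ℝ) / Real.sqrt ℓ) := by
  set c₁ : (Fin (n + 1) → Bool) → ℝ := fun x => if g x = Dk3 x k then (1 : ℝ) else 0 with hc₁
  set E : ℝ := 1 + 2 / (2 : ℝ) ^ K + 18 * (2 : ℝ) ^ K * ((Δ * L : ℕ) : ℝ) / Real.sqrt ℓ with hE
  have hc0 : ∀ x, 0 ≤ c₁ x := fun x => by rw [hc₁]; dsimp only; split_ifs <;> norm_num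
  -- the count as a sum over the odd class
  have hcount : ((univ.filter fun x : Fin (n + 1) → Bool =>
      (univ.filter fun j : Fin (n + 1) => x j = false).card % 2 = 1 ∧ g x = Dk3 x k).card : ℝ) =
      ∑ x : Fin (n + 1) → Bool,
        (if (univ.filter fun j : Fin (n + 1) => x j = false).card % 2 = 1 then c₁ x else 0) := by
    rw [natCast_card_filter]
    refine Finset.sum_congr rfl fun x _ => ?_
    by_cases h1 : (univ.filter fun j : Fin (n + 1) => x j = false).card % 2 = 1 <;> simp [h1, hc₁]
  rw [hcount]
  -- TRUE side, structured side
  have h1 := sum_odd_le hκ hκ0 haW hL c₁ hc0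
  have h2 : ∀ y : Fin (n + 1) → Bool,
      ∑ t : ZMod 3, Vsum a L m κ₀ c₁ y (affP (εb a L m y) t) ≤ (6 : ℝ) ^ m * E := fun y =>
    sum_Vsum_affP_le hκ hκ0 haW hk hL hℓ hLf hW y hg (εb a L m y)
  have h3 : ∑ y ∈ Yset a L m, ∑ t : ZMod 3, Vsum a L m κ₀ c₁ y (affP (εb a L m y) t) ≤
      ((Yset (n := n) a L m).card : ℝ) * ((6 : ℝ) ^ m * E) := by
    calc _ ≤ ∑ _y ∈ Yset a L m, (6 : ℝ) ^ m * E := Finset.sum_le_sum fun y _ => h2 y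
      _ = _ := by rw [sum_const, nsmul_eq_mul]
  have hY := card_Yset (n := n) (a := a) (L := L) (m := m) haW
  have hfm : (0 : ℝ) ≤ (((2 : ℝ) ^ L + 4) / 6) ^ (m + 1) := by positivity
  have h4 : ∑ x : Fin (n + 1) → Bool,
      (if (univ.filter fun j : Fin (n + 1) => x j = false).card % 2 = 1 then c₁ x else 0) ≤
      (((2 : ℝ) ^ L + 4) / 6) ^ (m + 1) * (((Yset (n := n) a L m).card : ℝ) * ((6 : ℝ) ^ m * E)) :=
    le_trans h1 (mul_le_mul_of_nonneg_left h3 hfm)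
  -- arithmetic: `((2^L+4)/6)^{m+1} · #Y · 6^m = 2^n (1+4/2^L)^{m+1} / 3`
  have h2L : (0 : ℝ) < (2 : ℝ) ^ L := by positivity
  have hpowW : (2 : ℝ) ^ ((m + 1) * L) = ((2 : ℝ) ^ L) ^ (m + 1) := by rw [← pow_mul, Nat.mul_comm]
  have hYval : ((Yset (n := n) a L m).card : ℝ) = (2 : ℝ) ^ (n + 1) / ((2 : ℝ) ^ L) ^ (m + 1) := by
    rw [← hpowW, eq_div_iff (by positivity)]; exact hY
  have key : (((2 : ℝ) ^ L + 4) / 6) ^ (m + 1) * (((Yset (n := n) a L m).card : ℝ) * ((6 : ℝ) ^ m * E)) =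
      (2 : ℝ) ^ n * (1 + 4 / (2 : ℝ) ^ L) ^ (m + 1) * E / 3 := by
    rw [hYval]
    have e1 : (((2 : ℝ) ^ L + 4) / 6) ^ (m + 1) = ((2 : ℝ) ^ L) ^ (m + 1) * (1 + 4 / (2 : ℝ) ^ L) ^ (m + 1) /
        ((6 : ℝ) ^ m * 6) := by
      rw [← pow_succ, ← mul_pow, ← div_pow]
      congr 1
      field_simp
    rw [e1, pow_succ (2 : ℝ) n]
    field_simp
    ring
  rw [key] at h4
  linarith

/-! ### Two growth lemmas -/

/-- `(1 + x)^M ≤ 1 + 2Mx` for `x ≥ 0`, `Mx ≤ 1/2` (Bernoulli for `(1−x)^M` and `(1−x²)^M ≤ 1`). -/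
theorem one_add_pow_le_of_small {x : ℝ} (hx : 0 ≤ x) {M : ℕ} (hM : (M : ℝ) * x ≤ 1 / 2) :
    (1 + x) ^ M ≤ 1 + 2 * M * x := by
  rcases Nat.eq_zero_or_pos M with rfl | hMpos
  · simp
  have hx1 : x ≤ 1 / 2 := by
    have : (1 : ℝ) ≤ M := by exact_mod_cast hMpos
    nlinarith
  have hB : 1 - (M : ℝ) * x ≤ (1 - x) ^ M := by
    have := one_add_mul_le_pow (show (-2 : ℝ) ≤ -x by linarith) M
    simpa [sub_eq_add_neg, mul_neg] using this
  have hprod : (1 + x) ^ M * (1 - x) ^ M ≤ 1 := by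
    rw [← mul_pow]
    apply pow_le_one₀ (by nlinarith) (by nlinarith)
  have hpos : 0 < 1 - (M : ℝ) * x := by linarith
  have h1 : (1 + x) ^ M * (1 - (M : ℝ) * x) ≤ 1 :=
    le_trans (mul_le_mul_of_nonneg_left hB (by positivity)) hprod
  -- `(1+x)^M ≤ 1/(1 − Mx) ≤ 1 + 2Mx`
  have h2 : (1 + x) ^ M ≤ 1 / (1 - (M : ℝ) * x) := by rw [le_div_iff₀ hpos]; exact h1
  refine le_trans h2 ?_
  rw [div_le_iff₀ hpos]
  have hMx0 : (0 : ℝ) ≤ (M : ℝ) * x := by positivity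
  nlinarith [mul_nonneg hMx0 (show (0 : ℝ) ≤ 1 - 2 * ((M : ℝ) * x) by linarith)]

/-- `B·(log₂ N)^d ≤ N` for all large `N`. -/
theorem const_mul_logPow_le' (B d : ℕ) : ∃ N₀ : ℕ, ∀ N ≥ N₀, B * (Nat.log 2 N) ^ d ≤ N := by
  obtain ⟨n₂, hn₂⟩ := TubePlanProof.logPow_le_natSqrt (d + 1)
  refine ⟨max n₂ (2 ^ B), fun N hN => ?_⟩
  have hN₂ : n₂ ≤ N := le_trans (le_max_left _ _) hN
  have hB : B ≤ Nat.log 2 N := Nat.le_log_of_pow_le one_lt_two (le_trans (le_max_right _ _) hN)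
  calc B * (Nat.log 2 N) ^ d ≤ Nat.log 2 N * (Nat.log 2 N) ^ d := Nat.mul_le_mul_right _ hB
    _ = (Nat.log 2 N) ^ (d + 1) := by ring
    _ ≤ Nat.sqrt N := hn₂ N hN₂
    _ ≤ N := Nat.sqrt_le_self N

/-! ### Parameter bookkeeping -/

/-- The window budget: with `ℓ = (A·L^C·L)²`, `G₀ = K(6ℓ+1)`, `m + 1 = G₀/L + 4`, the window `W = (m+1)L` satisfies
`G₀ + 3 ≤ W ≤ (7KA² + 4)·L^{2C+2}`. -/
theorem window_budget (K A L C : ℕ) (hL : 3 ≤ L) (hA : 1 ≤ A) :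
    K * (6 * (A * L ^ C * L) ^ 2 + 1) + 3 ≤ (K * (6 * (A * L ^ C * L) ^ 2 + 1) / L + 3 + 1) * L ∧
    (K * (6 * (A * L ^ C * L) ^ 2 + 1) / L + 3 + 1) * L ≤ (7 * K * A ^ 2 + 4) * L ^ (2 * C + 2) := by
  set ℓ := (A * L ^ C * L) ^ 2 with hℓ
  set G := K * (6 * ℓ + 1) with hG
  have hℓ1 : 1 ≤ ℓ := by
    have hA0 : 0 < A := hA
    have hL0 : 0 < L := by omega
    rw [hℓ]; exact Nat.one_le_pow _ _ (Nat.mul_pos (Nat.mul_pos hA0 (Nat.pow_pos hL0)) hL0)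
  have hdm : G / L * L + G % L = G := Nat.div_add_mod' G L
  have hml : G % L < L := Nat.mod_lt _ (by omega)
  have hdl : G / L * L ≤ G := Nat.div_mul_le_self _ _
  constructor
  · rw [Nat.add_mul, Nat.add_mul]; omega
  · have hℓeq : ℓ = A ^ 2 * L ^ (2 * C + 2) := by rw [hℓ]; ring
    have hLp : L ≤ L ^ (2 * C + 2) :=
      calc L = L ^ 1 := (pow_one L).symm
        _ ≤ L ^ (2 * C + 2) := Nat.pow_le_pow_right (by omega) (by omega)
    have hG7 : G ≤ 7 * K * ℓ := by rw [hG]; nlinarith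
    calc (G / L + 3 + 1) * L = G / L * L + 4 * L := by ring
      _ ≤ 7 * K * ℓ + 4 * L ^ (2 * C + 2) := by omega
      _ = (7 * K * A ^ 2 + 4) * L ^ (2 * C + 2) := by rw [hℓeq]; ring

/-- The Smolensky error: `18·2^K·ΔL/√((AΔL)²) ≤ ε/4` once `72·2^K/ε ≤ A`. -/
theorem err_sqrt_le {ε : ℝ} (hε : 0 < ε) {K A Δ L : ℕ} (hA : 72 * (2 : ℝ) ^ K / ε ≤ A) (hΔL : 1 ≤ Δ * L) :
    18 * (2 : ℝ) ^ K * ((Δ * L : ℕ) : ℝ) / Real.sqrt (((A * Δ * L) ^ 2 : ℕ) : ℝ) ≤ ε / 4 := by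
  have hDL : (1 : ℝ) ≤ ((Δ * L : ℕ) : ℝ) := by exact_mod_cast hΔL
  have hA' : 72 * (2 : ℝ) ^ K ≤ (A : ℝ) * ε := (div_le_iff₀ hε).1 hA
  have hApos : (0 : ℝ) < A := by
    have : (0 : ℝ) < 72 * (2 : ℝ) ^ K := by positivity
    nlinarith
  have hsq : Real.sqrt (((A * Δ * L) ^ 2 : ℕ) : ℝ) = (A : ℝ) * ((Δ * L : ℕ) : ℝ) := by
    push_cast
    rw [show ((A : ℝ) * Δ * L) ^ 2 = ((A : ℝ) * (Δ * L)) ^ 2 by ring]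
    exact Real.sqrt_sq (by positivity)
  rw [hsq, div_le_iff₀ (by positivity)]
  nlinarith

/-- The fibre-size error: `(1 + 4/2^L)^{M} ≤ 1 + ε/2` once `M·(4/2^L) ≤ ε/8 ≤ 1/8`. -/
theorem err_pow_le {ε : ℝ} (hε1 : ε ≤ 1) {L M : ℕ} (hM : (M : ℝ) * (4 / (2 : ℝ) ^ L) ≤ ε / 8) :
    (1 + 4 / (2 : ℝ) ^ L) ^ M ≤ 1 + ε / 2 := by
  have h := one_add_pow_le_of_small (show (0 : ℝ) ≤ 4 / (2 : ℝ) ^ L by positivity) (M := M) (by linarith)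
  calc (1 + 4 / (2 : ℝ) ^ L) ^ M ≤ 1 + 2 * (M : ℝ) * (4 / (2 : ℝ) ^ L) := h
    _ = 1 + 2 * ((M : ℝ) * (4 / (2 : ℝ) ^ L)) := by ring
    _ ≤ 1 + ε / 2 := by
        have : (0 : ℝ) ≤ (M : ℝ) * (4 / (2 : ℝ) ^ L) := by positivity
        linarith

/-- `M·(4/2^L) ≤ ε/8` from the integer budget `⌈64/ε⌉·M ≤ N < 2·2^L`. -/
theorem err_budget_le {ε : ℝ} (hε : 0 < ε) {L M N : ℕ} (hMN : ⌈64 / ε⌉₊ * M ≤ N) (hNL : (N : ℝ) < 2 * (2 : ℝ) ^ L) :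
    (M : ℝ) * (4 / (2 : ℝ) ^ L) ≤ ε / 8 := by
  have h2L : (0 : ℝ) < (2 : ℝ) ^ L := by positivity
  have hc : (64 / ε : ℝ) ≤ ⌈64 / ε⌉₊ := Nat.le_ceil _
  have h1 : ((⌈64 / ε⌉₊ * M : ℕ) : ℝ) ≤ N := by exact_mod_cast hMN
  push_cast at h1
  have hM0 : (0 : ℝ) ≤ M := by positivity
  have h2 : 64 / ε * (M : ℝ) ≤ N := le_trans (mul_le_mul_of_nonneg_right hc hM0) h1
  rw [div_mul_eq_mul_div, div_le_iff₀ hε] at h2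
  rw [mul_div_assoc', div_le_iff₀ h2L]
  nlinarith

/-- The final arithmetic. -/
theorem final_arith {ε ε' X P E T : ℝ} (hε'0 : 0 < ε') (hε'1 : ε' ≤ 1) (hε'ε : ε' ≤ ε) (hT : 0 < T)
    (hE0 : 0 ≤ E) (hP : P ≤ 1 + ε' / 2) (hE : E ≤ 1 + ε' / 2) (hX : 3 * X ≤ T * P * E) :
    3 * X ≤ T + ε * (2 * T) := by
  have h1 : P * E ≤ (1 + ε' / 2) * (1 + ε' / 2) := mul_le_mul hP hE hE0 (by linarith)
  have h2 : (1 + ε' / 2) * (1 + ε' / 2) ≤ 1 + 2 * ε := by nlinarith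
  have h3 : T * P * E ≤ T * (1 + 2 * ε) := by
    rw [mul_assoc]; exact mul_le_mul_of_nonneg_left (le_trans h1 h2) hT.le
  linarith

/-! ### THEOREM A′ -/

/-- **THEOREM A′ `PredHardDWB3` — PROVED** (ROUND-15 §2–§3: Kilian gauge lifted to the bits + structured law + Smolensky). -/
theorem predHardDWB3 : PredHardDWB3 := by
  intro ε hε C
  -- WLOG `ε ≤ 1`
  obtain ⟨ε', hε'0, hε'1, hε'ε⟩ : ∃ ε' : ℝ, 0 < ε' ∧ ε' ≤ 1 ∧ ε' ≤ ε :=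
    ⟨min ε 1, lt_min hε one_pos, min_le_right _ _, min_le_left _ _⟩
  -- `2^K ≥ 8/ε'`
  obtain ⟨K, hK⟩ : ∃ K : ℕ, 8 / ε' ≤ (2 : ℝ) ^ K := by
    obtain ⟨K, hK⟩ := pow_unbounded_of_one_lt (8 / ε') (by norm_num : (1 : ℝ) < 2)
    exact ⟨K, hK.le⟩
  -- `A ≥ 72·2^K/ε'`
  obtain ⟨A, hA1, hA⟩ : ∃ A : ℕ, 1 ≤ A ∧ 72 * (2 : ℝ) ^ K / ε' ≤ A :=
    ⟨⌈72 * (2 : ℝ) ^ K / ε'⌉₊ + 1, by omega, le_trans (Nat.le_ceil _) (by push_cast; linarith)⟩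
  -- the polylog budgets
  obtain ⟨N₁, hN₁⟩ := const_mul_logPow_le' (2 * (7 * K * A ^ 2 + 4) + 1) (2 * C + 2)
  obtain ⟨N₂, hN₂⟩ := const_mul_logPow_le' (⌈64 / ε'⌉₊ * (7 * K * A ^ 2 + 4)) (2 * C + 2)
  refine ⟨max (max N₁ N₂) 8, fun N hN k g hg => ?_⟩
  have hN1 : N₁ ≤ N := le_trans (le_trans (le_max_left _ _) (le_max_left _ _)) hN
  have hN2 : N₂ ≤ N := le_trans (le_trans (le_max_right _ _) (le_max_left _ _)) hN
  have hN8 : 8 ≤ N := le_trans (le_max_right _ _) hN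
  obtain ⟨n, rfl⟩ : ∃ n, N = n + 1 := ⟨N - 1, by omega⟩
  -- parameters (all functions of `L = log₂ N`)
  obtain ⟨L, hLdef⟩ : ∃ L : ℕ, L = Nat.log 2 (n + 1) := ⟨_, rfl⟩
  have hL3 : 3 ≤ L := by rw [hLdef]; exact Nat.le_log_of_pow_le (by norm_num) hN8
  have hbud := window_budget K A L C hL3 hA1
  obtain ⟨ℓ, hℓdef⟩ : ∃ ℓ : ℕ, ℓ = (A * L ^ C * L) ^ 2 := ⟨_, rfl⟩
  obtain ⟨m, hmdef⟩ : ∃ m : ℕ, m = K * (6 * ℓ + 1) / L + 3 := ⟨_, rfl⟩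
  rw [← hℓdef, ← hmdef] at hbud
  obtain ⟨hbud1, hbud2⟩ := hbud
  have hΔL : 1 ≤ L ^ C * L := le_trans (show 1 ≤ L by omega) (Nat.le_mul_of_pos_left L (Nat.one_le_pow _ _ (by omega)))
  have hℓ1 : 1 ≤ ℓ := by
    rw [hℓdef]; refine Nat.one_le_pow _ _ ?_
    calc 1 ≤ L ^ C * L := hΔL
      _ ≤ A * (L ^ C * L) := Nat.le_mul_of_pos_left _ hA1
      _ = A * L ^ C * L := (Nat.mul_assoc _ _ _).symm
  obtain ⟨Lf, hLfdef⟩ : ∃ Lf : ℕ, Lf = (m + 1) * L - K * (6 * ℓ + 1) := ⟨_, rfl⟩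
  have hLf3 : 3 ≤ Lf := by omega
  have hW : (m + 1) * L = K * (6 * ℓ + 1) + Lf := by omega
  -- `2W ≤ n` and the `ε`-budget, from `polylog ≤ N`
  have hpow1 : 1 ≤ (Nat.log 2 (n + 1)) ^ (2 * C + 2) := Nat.one_le_pow _ _ (by rw [← hLdef]; omega)
  have h2W : 2 * ((m + 1) * L) ≤ n := by
    have h := hN₁ (n + 1) hN1
    rw [← hLdef] at h hpow1
    have : 2 * ((m + 1) * L) + 1 ≤ (2 * (7 * K * A ^ 2 + 4) + 1) * L ^ (2 * C + 2) := by
      have := Nat.mul_le_mul_left 2 hbud2; nlinarith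
    omega
  have hMN : ⌈64 / ε'⌉₊ * (m + 1) ≤ n + 1 := by
    have h := hN₂ (n + 1) hN2
    rw [← hLdef] at h
    have hmW : m + 1 ≤ (7 * K * A ^ 2 + 4) * L ^ (2 * C + 2) := le_trans (by nlinarith) hbud2
    calc ⌈64 / ε'⌉₊ * (m + 1) ≤ ⌈64 / ε'⌉₊ * ((7 * K * A ^ 2 + 4) * L ^ (2 * C + 2)) := Nat.mul_le_mul_left _ hmW
      _ = ⌈64 / ε'⌉₊ * (7 * K * A ^ 2 + 4) * L ^ (2 * C + 2) := by ring
      _ ≤ n + 1 := h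
  -- window placement: constant weight on the window
  obtain ⟨a, hadef⟩ : ∃ a : ℕ, a = if (m + 1) * L ≤ k.val then 0 else n - (m + 1) * L := ⟨_, rfl⟩
  obtain ⟨κ₀, hκ₀def⟩ : ∃ κ₀ : ZMod 3, κ₀ = if (m + 1) * L ≤ k.val then 2 else 1 := ⟨_, rfl⟩
  have hκ : κ₀ ≠ 0 := by rw [hκ₀def]; split_ifs <;> decide
  have hk : k.val ≤ n := by have := k.isLt; omega
  have haW : a + (m + 1) * L ≤ n := by rw [hadef]; split_ifs <;> omega
  have hκ0 : KappaConst a L m κ₀ k.val := by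
    intro i hi1 hi2
    rw [hκ₀def]; unfold kappa
    by_cases hWk : (m + 1) * L ≤ k.val
    · rw [hadef, if_pos hWk] at hi1 hi2; rw [if_pos hWk, if_pos (by omega)]
    · rw [hadef, if_neg hWk] at hi1 hi2; rw [if_neg hWk, if_neg (by omega)]
  -- the main count
  have hg' : g ∈ lowDeg (ZMod 3) (n + 1) (L ^ C) := by rw [hLdef]; exact hg
  have hmain := card_predict_le hκ hκ0 haW hk hL3 hℓ1 hLf3 hW hg'
  -- the two error terms
  have h2K : (0 : ℝ) < (2 : ℝ) ^ K := by positivity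
  have hE1 : 2 / (2 : ℝ) ^ K ≤ ε' / 4 := by
    rw [div_le_iff₀ h2K]
    have : 8 ≤ ε' * (2 : ℝ) ^ K := by rwa [div_le_iff₀ hε'0, mul_comm] at hK
    linarith
  have hE2 : 18 * (2 : ℝ) ^ K * ((L ^ C * L : ℕ) : ℝ) / Real.sqrt ℓ ≤ ε' / 4 := by
    rw [hℓdef, show A * L ^ C * L = A * (L ^ C) * L from rfl]
    exact err_sqrt_le hε'0 (Δ := L ^ C) hA hΔL
  have hNL : ((n + 1 : ℕ) : ℝ) < 2 * (2 : ℝ) ^ L := by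
    have h := Nat.lt_pow_succ_log_self (b := 2) one_lt_two (n + 1)
    rw [← hLdef, pow_succ] at h
    have h' : ((n + 1 : ℕ) : ℝ) < ((2 ^ L * 2 : ℕ) : ℝ) := by exact_mod_cast h
    have h'' : ((2 ^ L * 2 : ℕ) : ℝ) = 2 * (2 : ℝ) ^ L := by push_cast; ring
    linarith
  have hMx := err_budget_le hε'0 hMN hNL
  have hR3 := err_pow_le hε'1 (M := m + 1) (by exact_mod_cast hMx)
  -- assemble
  simp only [Nat.add_sub_cancel]
  have hpow : (2 : ℝ) ^ (n + 1) = 2 * (2 : ℝ) ^ n := by ring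
  rw [hpow]
  exact final_arith hε'0 hε'1 hε'ε (by positivity) (by positivity) hR3 (by linarith) hmain

/-- **R3 `OneBellDWB3` (Sketch18 §6, domain-wall blindness) — PROVED.** -/
theorem oneBellDWB3 : OneBellDWB3 := oneBellOfPred predHardDWB3

end DWalk

end Summit.QuantumAdvantage.AdviceFreeQNC0

end
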